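import Summits.BirchSwinnertonDyer.Rank1Residual.X11b.Three.KodairaTransportBasic
import HarnessLib

/-!
# X11b at `p = 3` (team N8/O2), cross-cell service (o5o6 TARGETS (G4-6)(i)): Tate's algorithm is
# equivariant under UNRAMIFIED local homomorphisms of discrete valuation rings —
# part 2/4: coupling a run over `R₁` with a run over `R₂`; the `Iₙ*` sub-procedure

HONEST FRAMING (cell `b2b-bsdres`, run/shared/lean/b2b/bsd-rank1-residual/, verbatim in every
file): the goal of the cell is to DELETE the COMBINATION-SHAPED residual classes of the
Birch–Swinnerton-Dyer formula for ALL analytic-rank `≤ 1` elliptic curves over `ℚ` — "full BSD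
formula for every rank `≤ 1` curve in class `C`" assembled STRICTLY from published theorems — so
that the rank-`≤ 1` remainder becomes exactly the CONSTRUCTION-SHAPED classes, which are TYPED
(missing-input `Prop`s), NOT attempted. This is not "finishing BSD". Team N8/O2 = `x11b3`, seat
`b2b-bsdres-x11b3-p4` (lead GEN 7 R8-4 (b), menu (2)). THEOREMS ONLY: no definition, no named
fact, no `sorry`; nothing is booked; no mark / label / count moves.

## What

Part 2 of the generalisation of the tree's `TateAlgorithmRingEquivProofs` from ring isomorphisms
to UNRAMIFIED local homomorphisms `ψ : R₁ →+* R₂` (`[IsLocalHom ψ]`, `ψ π₁ = w π₂`): the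
coupling lemmas `smul_map_eq_conj_smul_of_unif`, `conj_u_eq_one_of_unif`,
`addVal_Δ_map_toNat_of_unif` (`ord₂ Δ(ψW) = ord₁ Δ(W)`), and the coupled induction for Step 7
(`istarIndexAux_map_eq_of_unif`, `istarIndex_map_eq_of_unif`) — the tree's proofs verbatim with
the rigidity lemmas of `TateAlgorithmInvarianceProofs` over `R₂` and the root-count transport of
part 1. Perfect residue fields are needed only for the existence of the normalising translations.

References (locators only; no new fact): [cite: SilvermanATAEC1994, IV.9.4 Step 7 (PDF pp. 344–346,
351–353)] [cite: Tate1975, §§7–8].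

## Design

No definitions. Axioms: `propext`, `Classical.choice`, `Quot.sound`.
-/

open Polynomial IsLocalRing

namespace Summit.BirchSwinnertonDyer.Rank1Residual.X11b.Three.KodairaTransport

open Literature.NumberTheory.DiophantineGeometry Literature.NumberTheory.DiophantineGeometry.TateAlgorithm
  WeierstrassCurve

/-! ### Coupling a run over `R₁` with a run over `R₂` -/

section Coupling

variable {R₁ R₂ : Type*} [CommRing R₁] [IsDomain R₁] [IsDiscreteValuationRing R₁]
  [CommRing R₂] [IsDomain R₂] [IsDiscreteValuationRing R₂] (ψ : R₁ →+* R₂) [IsLocalHom ψ]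

omit [IsDomain R₁] [IsDiscreteValuationRing R₁] [IsDomain R₂] [IsDiscreteValuationRing R₂]
  [IsLocalHom ψ] in
/-- If `W' = E • ψW`, `W₁ = C • W`, `W₁' = C' • W'` then `W₁' = (C' E (ψC)⁻¹) • ψW₁`. [folklore] -/
theorem smul_map_eq_conj_smul_of_unif {W W₁ : WeierstrassCurve R₁} {W' W₁' : WeierstrassCurve R₂}
    {E C' : WeierstrassCurve.VariableChange R₂} {C : WeierstrassCurve.VariableChange R₁}
    (hrel : W' = E • W.map ψ) (h₁ : W₁ = C • W) (h₁' : W₁' = C' • W') :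
    W₁' = (C' * E * (C.map ψ)⁻¹) • W₁.map ψ := by
  rw [h₁', hrel, h₁, ← WeierstrassCurve.map_variableChange, mul_smul, mul_smul, inv_smul_smul]

omit [IsDomain R₁] [IsDiscreteValuationRing R₁] [IsDomain R₂] [IsDiscreteValuationRing R₂]
  [IsLocalHom ψ] in
/-- The coupling changes keep `u = 1`. [folklore] -/
theorem conj_u_eq_one_of_unif {E C' : WeierstrassCurve.VariableChange R₂}
    {C : WeierstrassCurve.VariableChange R₁} (hC' : C'.u = 1) (hE : E.u = 1) (hC : C.u = 1) :
    (C' * E * (C.map ψ)⁻¹).u = 1 := by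
  simp [WeierstrassCurve.VariableChange.mul_def, WeierstrassCurve.VariableChange.inv_def,
    WeierstrassCurve.VariableChange.map, hC', hE, hC]

omit [IsLocalHom ψ] in
/-- `ord Δ` is transported: `ord₂ Δ(ψW) = ord₁ Δ(W)`. [folklore] -/
theorem addVal_Δ_map_toNat_of_unif {w : R₂ˣ} (hw : ψ (uniformizer R₁) = ↑w * uniformizer R₂)
    (W : WeierstrassCurve R₁) :
    (IsDiscreteValuationRing.addVal R₂ (W.map ψ).Δ).toNat =
      (IsDiscreteValuationRing.addVal R₁ W.Δ).toNat := by
  rw [WeierstrassCurve.map_Δ, addVal_map_eq_of_unif ψ hw]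

variable {w : R₂ˣ}

/-- **The `Iₙ*` sub-procedure across `ψ`** (coupled induction on the fuel): if `W' = E • ψW`
with `E` a `u = 1` change over `R₂` and both `W` (over `R₁`) and `W'` (over `R₂`) are normalised
for the start of round `m`, then `istarIndexAux` returns the same value on both.  Same coupling
as `istarIndexAux_smul_eq`, the base model of the `R₂`-run being compared with the image
`ψWₖ` of the `R₁`-run (rigidity `dvd_r_s_t_of_step7/7b` over `R₂`, test invariance
`distinctRootCount_quadratic₁/₂_smul` over `R₂` and `…_map` across `ψ`).
Silverman ATAEC IV.9.4, Step 7. [cite: SilvermanATAEC1994, IV.9.4 Step 7] -/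
theorem istarIndexAux_map_eq_of_unif [PerfectField (ResidueField R₁)] [PerfectField (ResidueField R₂)]
    (hw : ψ (uniformizer R₁) = ↑w * uniformizer R₂) (fuel : ℕ) :
    ∀ (m : ℕ) {W : WeierstrassCurve R₁} {W' : WeierstrassCurve R₂}
      {E : WeierstrassCurve.VariableChange R₂},
      W' = E • W.map ψ → E.u = 1 →
      uniformizer R₁ ∣ W.a₁ → uniformizer R₁ ∣ W.a₂ → ¬ uniformizer R₁ ^ 2 ∣ W.a₂ →
      uniformizer R₁ ^ (m + 2) ∣ W.a₃ → uniformizer R₁ ^ (m + 3) ∣ W.a₄ →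
      uniformizer R₁ ^ (2 * m + 4) ∣ W.a₆ →
      uniformizer R₂ ∣ W'.a₁ → uniformizer R₂ ∣ W'.a₂ → ¬ uniformizer R₂ ^ 2 ∣ W'.a₂ →
      uniformizer R₂ ^ (m + 2) ∣ W'.a₃ → uniformizer R₂ ^ (m + 3) ∣ W'.a₄ →
      uniformizer R₂ ^ (2 * m + 4) ∣ W'.a₆ →
      istarIndexAux fuel m W' = istarIndexAux fuel m W := by
  classical
  induction fuel with
  | zero => intros; rw [istarIndexAux_zero, istarIndexAux_zero]
  | succ fuel ih =>
    intro m W W' E hrel hu h1 h2 h2n h3 h4 h6 h1' h2' h2n' h3' h4' h6'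
    rw [istarIndexAux_succ, istarIndexAux_succ]
    -- the image of the `R₁`-model and rigidity of `E`
    have v1 : uniformizer R₂ ∣ (W.map ψ).a₁ := by
      rw [WeierstrassCurve.map_a₁, dvd_map_iff_of_unif ψ hw]; exact h1
    have v2 : uniformizer R₂ ∣ (W.map ψ).a₂ := by
      rw [WeierstrassCurve.map_a₂, dvd_map_iff_of_unif ψ hw]; exact h2
    have v2n : ¬ uniformizer R₂ ^ 2 ∣ (W.map ψ).a₂ := by
      rw [WeierstrassCurve.map_a₂, pow_dvd_map_iff_of_unif ψ hw]; exact h2n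
    have v3 : uniformizer R₂ ^ (m + 2) ∣ (W.map ψ).a₃ := by
      rw [WeierstrassCurve.map_a₃, pow_dvd_map_iff_of_unif ψ hw]; exact h3
    have v4 : uniformizer R₂ ^ (m + 3) ∣ (W.map ψ).a₄ := by
      rw [WeierstrassCurve.map_a₄, pow_dvd_map_iff_of_unif ψ hw]; exact h4
    have v6 : uniformizer R₂ ^ (2 * m + 4) ∣ (W.map ψ).a₆ := by
      rw [WeierstrassCurve.map_a₆, pow_dvd_map_iff_of_unif ψ hw]; exact h6
    rw [hrel] at h1' h2' h2n' h3' h4' h6'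
    obtain ⟨hr, hs, ht⟩ := dvd_r_s_t_of_step7 hu v1 v2 v2n v3 v4 v6 h1' h2' h3' h4' h6'
    -- first test
    have iffA : distinctRootCount (X ^ 2 + C (redCoeff (E • W.map ψ).a₃ (m + 2)) * X
        - C (redCoeff (E • W.map ψ).a₆ (2 * m + 4))) = 2 ↔
        distinctRootCount (X ^ 2 + C (redCoeff W.a₃ (m + 2)) * X
        - C (redCoeff W.a₆ (2 * m + 4))) = 2 := by
      rw [distinctRootCount_quadratic₁_smul hu v1 v2 v3 v4 v6 hr hs ht,
        distinctRootCount_quadratic₁_map_of_unif ψ hw W m]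
    rw [hrel]
    by_cases hA : distinctRootCount (X ^ 2 + C (redCoeff W.a₃ (m + 2)) * X
        - C (redCoeff W.a₆ (2 * m + 4))) = 2
    · rw [if_pos hA, if_pos (iffA.mpr hA)]
    have hA' := fun h => hA (iffA.mp h)
    rw [if_neg hA, if_neg hA']
    -- the `y`-translations exist on both sides
    have hexA := exists_normalize_istarA h1 h2 h3 h4 h6 hA
    have hexA' := exists_normalize_istarA h1' h2' h3' h4' h6' hA'
    rw [dif_pos hexA, dif_pos hexA']
    simp only []
    obtain ⟨k1, k2, k2n, k3, k4, k6⟩ := istarA_spec h1 h2 h2n h3 h4 h6 hexA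
    obtain ⟨k1', k2', k2n', k3', k4', k6'⟩ := istarA_spec h1' h2' h2n' h3' h4' h6' hexA'
    set W₁ := hexA.choose • W with hW₁
    set W₁' := hexA'.choose • (E • W.map ψ) with hW₁'
    -- coupling of the translated models
    have hrel₁ : W₁' = (hexA'.choose * E * (hexA.choose.map ψ)⁻¹) •
        W₁.map ψ := smul_map_eq_conj_smul_of_unif ψ rfl hW₁ hW₁'
    have hu₁ : (hexA'.choose * E * (hexA.choose.map ψ)⁻¹).u = 1 :=
      conj_u_eq_one_of_unif ψ hexA'.choose_spec.1 hu hexA.choose_spec.1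
    set E₁ := hexA'.choose * E * (hexA.choose.map ψ)⁻¹ with hE₁
    clear_value W₁ W₁' E₁
    have x1 : uniformizer R₂ ∣ (W₁.map ψ).a₁ := by
      rw [WeierstrassCurve.map_a₁, dvd_map_iff_of_unif ψ hw]; exact k1
    have x2 : uniformizer R₂ ∣ (W₁.map ψ).a₂ := by
      rw [WeierstrassCurve.map_a₂, dvd_map_iff_of_unif ψ hw]; exact k2
    have x2n : ¬ uniformizer R₂ ^ 2 ∣ (W₁.map ψ).a₂ := by
      rw [WeierstrassCurve.map_a₂, pow_dvd_map_iff_of_unif ψ hw]; exact k2n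
    have x3 : uniformizer R₂ ^ (m + 3) ∣ (W₁.map ψ).a₃ := by
      rw [WeierstrassCurve.map_a₃, pow_dvd_map_iff_of_unif ψ hw]; exact k3
    have x4 : uniformizer R₂ ^ (m + 3) ∣ (W₁.map ψ).a₄ := by
      rw [WeierstrassCurve.map_a₄, pow_dvd_map_iff_of_unif ψ hw]; exact k4
    have x6 : uniformizer R₂ ^ (2 * m + 5) ∣ (W₁.map ψ).a₆ := by
      rw [WeierstrassCurve.map_a₆, pow_dvd_map_iff_of_unif ψ hw]; exact k6
    rw [hrel₁] at k1' k2' k2n' k3' k4' k6'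
    obtain ⟨hr₁, hs₁, ht₁⟩ := dvd_r_s_t_of_step7b hu₁ x1 x2 x2n x3 x4 x6 k1' k2' k3' k4' k6'
    -- second test
    have iffB : distinctRootCount (C (redCoeff (E₁ • W₁.map ψ).a₂ 1) * X ^ 2
        + C (redCoeff (E₁ • W₁.map ψ).a₄ (m + 3)) * X
        + C (redCoeff (E₁ • W₁.map ψ).a₆ (2 * m + 5))) = 2 ↔
        distinctRootCount (C (redCoeff W₁.a₂ 1) * X ^ 2 + C (redCoeff W₁.a₄ (m + 3)) * X
        + C (redCoeff W₁.a₆ (2 * m + 5))) = 2 := by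
      rw [distinctRootCount_quadratic₂_smul hu₁ x1 x2 x3 x4 x6 hr₁ hs₁ ht₁,
        distinctRootCount_quadratic₂_map_of_unif ψ hw W₁ m]
    rw [hrel₁]
    by_cases hB : distinctRootCount (C (redCoeff W₁.a₂ 1) * X ^ 2 + C (redCoeff W₁.a₄ (m + 3)) * X
        + C (redCoeff W₁.a₆ (2 * m + 5))) = 2
    · rw [if_pos hB, if_pos (iffB.mpr hB)]
    have hB' := fun h => hB (iffB.mp h)
    rw [if_neg hB, if_neg hB']
    -- the `x`-translations exist on both sides
    have hexB := exists_normalize_istarB k1 k2 k2n k3 k4 k6 hB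
    have hexB' := exists_normalize_istarB k1' k2' k2n' k3' k4' k6' hB'
    rw [dif_pos hexB, dif_pos hexB']
    obtain ⟨j1, j2, j2n, j3, j4, j6⟩ := istarB_spec k1 k2 k2n k3 k4 k6 hexB
    obtain ⟨j1', j2', j2n', j3', j4', j6'⟩ := istarB_spec k1' k2' k2n' k3' k4' k6' hexB'
    have hrel₂ : hexB'.choose • (E₁ • W₁.map ψ) =
        (hexB'.choose * E₁ * (hexB.choose.map ψ)⁻¹) •
          (hexB.choose • W₁).map ψ :=
      smul_map_eq_conj_smul_of_unif ψ rfl rfl rfl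
    exact ih (m + 1) hrel₂ (conj_u_eq_one_of_unif ψ hexB'.choose_spec.1 hu₁ hexB.choose_spec.1)
      j1 j2 j2n j3 j4 j6 j1' j2' j2n' j3' j4' j6'

/-- **`istarIndex` across `ψ`**: for a step-6 normalised `W` over `R₁` and a step-6 normalised
`W' = E • ψW` over `R₂` (`E` with `u = 1`) whose cubics have exactly two distinct roots, the
initial `x`-translations exist on both sides (perfect residue fields), the translated models
satisfy `π ∥ a₂`, and `istarIndexAux_map_eq_of_unif` applies with the common fuel `ord Δ`.
Silverman ATAEC IV.9.4, Step 7. [cite: SilvermanATAEC1994, IV.9.4 Step 7] -/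
theorem istarIndex_map_eq_of_unif [PerfectField (ResidueField R₁)] [PerfectField (ResidueField R₂)]
    (hw : ψ (uniformizer R₁) = ↑w * uniformizer R₂) {W : WeierstrassCurve R₁}
    {W' : WeierstrassCurve R₂} {E : WeierstrassCurve.VariableChange R₂}
    (hrel : W' = E • W.map ψ) (hu : E.u = 1)
    (h1 : uniformizer R₁ ∣ W.a₁) (h2 : uniformizer R₁ ∣ W.a₂) (h3 : uniformizer R₁ ^ 2 ∣ W.a₃)
    (h4 : uniformizer R₁ ^ 2 ∣ W.a₄) (h6 : uniformizer R₁ ^ 3 ∣ W.a₆)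
    (h1' : uniformizer R₂ ∣ W'.a₁) (h2' : uniformizer R₂ ∣ W'.a₂)
    (h3' : uniformizer R₂ ^ 2 ∣ W'.a₃) (h4' : uniformizer R₂ ^ 2 ∣ W'.a₄)
    (h6' : uniformizer R₂ ^ 3 ∣ W'.a₆)
    (h7 : distinctRootCount (cubicStep6 W) = 2) (h7' : distinctRootCount (cubicStep6 W') = 2) :
    istarIndex W' = istarIndex W := by
  classical
  have hex := exists_variableChange_step7_of_dvd h1 h2 h3 h4 h6 h7
  have hex' := exists_variableChange_step7_of_dvd h1' h2' h3' h4' h6' h7'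
  unfold istarIndex
  rw [dif_pos hex, dif_pos hex']
  simp only []
  have hf : (IsDiscreteValuationRing.addVal R₂ W'.Δ).toNat =
      (IsDiscreteValuationRing.addVal R₁ W.Δ).toNat := by
    rw [hrel, addVal_Δ_smul_toNat, addVal_Δ_map_toNat_of_unif ψ hw]
  rw [hf]
  -- specs of the translated models
  obtain ⟨huC, m1, m2, m3, m4, m6⟩ := hex.choose_spec
  have k1 := mem_maximalIdeal_iff_dvd.mp m1
  have k2 := mem_maximalIdeal_iff_dvd.mp m2
  have k3 := mem_maximalIdeal_pow_iff_dvd.mp m3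
  have k4 := mem_maximalIdeal_pow_iff_dvd.mp m4
  have k6 := mem_maximalIdeal_pow_iff_dvd.mp m6
  obtain ⟨huC', m1', m2', m3', m4', m6'⟩ := hex'.choose_spec
  have k1' := mem_maximalIdeal_iff_dvd.mp m1'
  have k2' := mem_maximalIdeal_iff_dvd.mp m2'
  have k3' := mem_maximalIdeal_pow_iff_dvd.mp m3'
  have k4' := mem_maximalIdeal_pow_iff_dvd.mp m4'
  have k6' := mem_maximalIdeal_pow_iff_dvd.mp m6'
  have d23 : uniformizer R₁ ^ 2 ∣ uniformizer R₁ ^ 3 := pow_dvd_pow _ (by norm_num)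
  have d34 : uniformizer R₁ ^ 3 ∣ uniformizer R₁ ^ 4 := pow_dvd_pow _ (by norm_num)
  have d23' : uniformizer R₂ ^ 2 ∣ uniformizer R₂ ^ 3 := pow_dvd_pow _ (by norm_num)
  have d34' : uniformizer R₂ ^ 3 ∣ uniformizer R₂ ^ 4 := pow_dvd_pow _ (by norm_num)
  -- `π ∥ a₂` on the translated models (one ring at a time)
  have k2n : ¬ uniformizer R₁ ^ 2 ∣ (hex.choose • W).a₂ := by
    obtain ⟨hr, hs, ht⟩ := dvd_r_s_t_of_step6 huC h1 h2 h3 h4 h6 k1 k2 k3 (d23.trans k4)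
      (d34.trans k6)
    refine not_sq_dvd_a₂_of_distinctRootCount_eq_two k4 k6 ?_
    rw [distinctRootCount_cubicStep6_smul huC h1 h2 h3 h4 h6 hr hs ht]; exact h7
  have k2n' : ¬ uniformizer R₂ ^ 2 ∣ (hex'.choose • W').a₂ := by
    obtain ⟨hr, hs, ht⟩ := dvd_r_s_t_of_step6 huC' h1' h2' h3' h4' h6' k1' k2' k3'
      (d23'.trans k4') (d34'.trans k6')
    refine not_sq_dvd_a₂_of_distinctRootCount_eq_two k4' k6' ?_
    rw [distinctRootCount_cubicStep6_smul huC' h1' h2' h3' h4' h6' hr hs ht]; exact h7'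
  have hrel₇ : hex'.choose • W' =
      (hex'.choose * E * (hex.choose.map ψ)⁻¹) •
        (hex.choose • W).map ψ :=
    smul_map_eq_conj_smul_of_unif ψ hrel rfl rfl
  exact istarIndexAux_map_eq_of_unif ψ hw _ 0 hrel₇ (conj_u_eq_one_of_unif ψ huC' hu huC) k1 k2 k2n k3 k4 k6
    k1' k2' k2n' k3' k4' k6'

end Coupling

end Summit.BirchSwinnertonDyer.Rank1Residual.X11b.Three.KodairaTransport
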